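import Literature.NumberTheory.BeurlingPrimes.BDRMultisetContZeta
import Mathlib.Analysis.Calculus.IteratedDeriv.Lemmas
import Mathlib.Analysis.SpecialFunctions.ExpDeriv
import Mathlib.Analysis.Calculus.Deriv.Star
import Mathlib.Analysis.Complex.CauchyIntegral
import HarnessLib

/-!
# BDR Theorem 3.2, the residues at `ω ∈ 𝒮_>`: `Res_{s=ω} x^{s+1}ζ_𝒫(s)/(s(s+1)) = x^{1+ω} Σ_i β_{ω,i}(log x)^i`

Topic `Literature/NumberTheory/BeurlingPrimes`, grouping namespace `BDRMultiset`. Everything in this file is PROVED.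

Broucke–Debruyne–Révész (2023), proof of Theorem 3.2: "Applying the residue theorem, we find that the integral in
(3.5) equals `a (x+1)²−x²)/2 + Σ_{ω∈𝒮_>} Res_{s=ω}( ((x+1)^{s+1} − x^{s+1})/(s(s+1)) ζ_𝒫(s) ) + …` where
`Res_{s=ω} x^{s+1}ζ_𝒫(s)/(s(s+1)) = x^{1+ω} Σ_{i=0}^{m_𝒮(ω)−1} β̃_{ω,i}(log x)^i`, `β̃_{ω,m_𝒮(ω)−1} ≠ 0`, say. By
Lemma 3.3 … `x^ω Σ_{i} b̃_{ω,i}(log x)^i + O(…)` for certain `b̃_{ω,i}` with `b̃_{ω,m_𝒮(ω)−1} ≠ 0`". Here, with the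
numerator `hOmega ω` of `BDRMultisetContZeta.lean` (`E_M e^Z = hOmega ω/(s−ω)^{m_ω}`) and
`kOmega ω s = hOmega ω s/(s(s+1))`:

* `Rfun ω y = (1/(m−1)!) (d/ds)^{m−1}[y^{1+s} kOmega ω s]_{s=ω}` (the residue of `y^{1+s}kOmega/(s−ω)^m`) and
  **`Rfun_eq`**: `Rfun ω y = y^{1+ω} Σ_{i<m} β_{ω,i} (log y)^i` (Leibniz), `betaC ω i = C(m−1,i) kOmega^{(m−1−i)}(ω)/(m−1)!`;
* the derivative coefficients `bCoef ω j = (1+ω)β_{ω,j} + (j+1)β_{ω,j+1}` with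
  **`hasDerivAt_cpow_mul_logPoly`** — `d/dy [y^θ Σ_{j<m} c_j (log y)^j] = y^{θ−1} Σ_{j<m} (θc_j + (j+1)c_{j+1})(log y)^j`;
* **`bCoef_top_ne_zero`** — `b_{ω,m−1} = (1+ω) kOmega(ω)(ω)/(m−1)! ≠ 0` (`ℛ ∩ 𝒮 = ∅`, `Re ω > 1/2 > δ`);
* **`bCoef_conj`** — `b_{ω̄,j} = \overline{b_{ω,j}}` for symmetric data (`iteratedDeriv_conj_comp_conj`).

## References
* [BrouckeDebruyneRevesz2023] F. Broucke, G. Debruyne, Sz. Gy. Révész, *Some examples of well-behaved Beurling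
  number systems*, arXiv:2309.01567, proof of Theorem 3.2 (residues at `ω ∈ 𝒮_>`, Lemma 3.3 step) (read).
-/

noncomputable section

open Filter Topology Complex Set
open scoped ComplexConjugate Nat

namespace Literature.NumberTheory.BeurlingPrimes

namespace BDRMultiset

variable {R S : Multiset ℂ} {δ : ℝ} {M : ℕ} {Z : ℂ → ℂ}

/-! ### Conjugation symmetry of (iterated) derivatives -/

/-- `deriv (s ↦ conj g(conj s)) z = conj (deriv g (conj z))`, unconditionally. [folklore] -/
theorem deriv_conj_conj (g : ℂ → ℂ) (z : ℂ) :
    deriv (fun s ↦ conj (g (conj s))) z = conj (deriv g (conj z)) := by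
  have hfun : (fun s ↦ conj (g (conj s))) = conj ∘ g ∘ conj := rfl
  by_cases h : DifferentiableAt ℂ g (conj z)
  · have h1 := h.hasDerivAt.conj_conj
    rw [Complex.conj_conj] at h1
    rw [hfun, h1.deriv]
  · have h2 : ¬DifferentiableAt ℂ (fun s ↦ conj (g (conj s))) z := by
      intro hd
      have h3 := hd.hasDerivAt.conj_conj
      have hg : (conj ∘ (fun s ↦ conj (g (conj s))) ∘ conj) = g := by
        funext s; simp
      rw [hg] at h3
      exact h h3.differentiableAt
    rw [deriv_zero_of_not_differentiableAt h, deriv_zero_of_not_differentiableAt h2, map_zero]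

/-- **`(s ↦ conj k(conj s))^{(n)} = s ↦ conj (k^{(n)}(conj s))`**, unconditionally. [folklore] -/
theorem iteratedDeriv_conj_comp_conj (k : ℂ → ℂ) (n : ℕ) :
    iteratedDeriv n (fun s ↦ conj (k (conj s))) = fun z ↦ conj (iteratedDeriv n k (conj z)) := by
  induction n with
  | zero => simp
  | succ n ih =>
    rw [iteratedDeriv_succ, ih, iteratedDeriv_succ]
    funext z
    exact deriv_conj_conj (iteratedDeriv n k) z

/-! ### The residue function and its explicit form -/

/-- `kOmega ω s = hOmega ω s/(s(s+1))` (the Perron denominator absorbed). [cite: BrouckeDebruyneRevesz2023, proof of Theorem 3.2] -/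
def kOmega (R S : Multiset ℂ) (δ : ℝ) (M : ℕ) (Z : ℂ → ℂ) (ω s : ℂ) : ℂ := hOmega R S δ M Z ω s / (s * (s + 1))

/-- `β_{ω,i} = C(m−1,i) kOmega^{(m−1−i)}(ω)/(m−1)!`, `m = count ω 𝒮`. [cite: BrouckeDebruyneRevesz2023, proof of Theorem 3.2 ("β̃_{ω,i}")] -/
def betaC (R S : Multiset ℂ) (δ : ℝ) (M : ℕ) (Z : ℂ → ℂ) (ω : ℂ) (i : ℕ) : ℂ :=
  ((S.count ω - 1).choose i : ℂ) * iteratedDeriv (S.count ω - 1 - i) (kOmega R S δ M Z ω) ω /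
    ((S.count ω - 1)! : ℂ)

/-- `b_{ω,j} = (1+ω)β_{ω,j} + (j+1)β_{ω,j+1}` (the coefficients of `d/dx[x^{1+ω}Σβ_i(log x)^i] = x^ω Σ b_j (log x)^j`).
[cite: BrouckeDebruyneRevesz2023, Theorem 3.2 ("b_{ω,i}")] -/
def bCoef (R S : Multiset ℂ) (δ : ℝ) (M : ℕ) (Z : ℂ → ℂ) (ω : ℂ) (j : ℕ) : ℂ :=
  (1 + ω) * betaC R S δ M Z ω j + (j + 1) * betaC R S δ M Z ω (j + 1)

/-- The residue function `Rfun ω y = (1/(m−1)!) (d/ds)^{m−1}[y^{1+s} kOmega ω s]_{s=ω}`.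
[cite: BrouckeDebruyneRevesz2023, proof of Theorem 3.2 ("Res_{s=ω} x^{s+1}ζ_𝒫(s)/(s(s+1))")] -/
def Rfun (R S : Multiset ℂ) (δ : ℝ) (M : ℕ) (Z : ℂ → ℂ) (ω : ℂ) (y : ℝ) : ℂ :=
  iteratedDeriv (S.count ω - 1) (fun s ↦ (y : ℂ) ^ (1 + s) * kOmega R S δ M Z ω s) ω / ((S.count ω - 1)! : ℂ)

/-- `y^{1+s} = y · e^{(log y) s}` for `y > 0`. [folklore] -/
theorem cpow_one_add_eq {y : ℝ} (hy : 0 < y) (s : ℂ) :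
    (y : ℂ) ^ (1 + s) = (y : ℂ) * Complex.exp ((Real.log y : ℂ) * s) := by
  have hy0 : (y : ℂ) ≠ 0 := ofReal_ne_zero.2 hy.ne'
  rw [Complex.cpow_add _ _ hy0, Complex.cpow_one, Complex.cpow_def_of_ne_zero hy0, ← Complex.ofReal_log hy.le]

/-- `(d/ds)^i y^{1+s} = (log y)^i y^{1+s}` (`y > 0`). [folklore] -/
theorem iteratedDeriv_cpow_one_add {y : ℝ} (hy : 0 < y) (i : ℕ) (s : ℂ) :
    iteratedDeriv i (fun s : ℂ ↦ (y : ℂ) ^ (1 + s)) s = (Real.log y : ℂ) ^ i * (y : ℂ) ^ (1 + s) := by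
  have hfun : (fun s : ℂ ↦ (y : ℂ) ^ (1 + s)) = fun s ↦ (y : ℂ) * Complex.exp ((Real.log y : ℂ) * s) :=
    funext fun s ↦ cpow_one_add_eq hy s
  rw [hfun, iteratedDeriv_const_mul_field, iteratedDeriv_cexp_const_mul, cpow_one_add_eq hy]
  ring

/-- `s ↦ y^{1+s}` is smooth. [folklore] -/
theorem contDiff_cpow_one_add {y : ℝ} (hy : 0 < y) {n : WithTop ℕ∞} : ContDiff ℂ n fun s : ℂ ↦ (y : ℂ) ^ (1 + s) := by
  have hfun : (fun s : ℂ ↦ (y : ℂ) ^ (1 + s)) = fun s ↦ (y : ℂ) * Complex.exp ((Real.log y : ℂ) * s) :=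
    funext fun s ↦ cpow_one_add_eq hy s
  rw [hfun]
  exact contDiff_const.mul (Complex.contDiff_exp.comp (contDiff_const.mul contDiff_id))

/-- `kOmega ω` is differentiable at `z` with `Re z > 1/2`, `z ≠ 1`, `z ≠ ω'` (`ω' ∈ 𝒮 ∖ {ω}`). [folklore] -/
theorem differentiableAt_kOmega (hδ2 : δ < 1 / 2) {ω z : ℂ} (hz : 1 / 2 < z.re) (hz1 : z ≠ 1)
    (hzS : ∀ ω' ∈ S, ω' ≠ ω → z ≠ ω') (hZ : DifferentiableAt ℂ Z z) :
    DifferentiableAt ℂ (kOmega R S δ M Z ω) z := by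
  have hz0 : z ≠ 0 := fun h ↦ by rw [h] at hz; simp at hz; linarith
  have hz1' : z + 1 ≠ 0 := fun h ↦ by
    have := congrArg Complex.re h; simp at this; linarith
  unfold kOmega
  exact (differentiableAt_hOmega hδ2 hz hz1 hzS hZ).div (differentiableAt_id.mul (differentiableAt_id.add_const 1))
    (mul_ne_zero hz0 hz1')

/-- `kOmega ω` is `C^∞` at `ω` when `Re ω > 1/2`, `ω ≠ 1` and `Z` is holomorphic on `Re s > 1/2`. [folklore] -/
theorem contDiffAt_kOmega (hδ2 : δ < 1 / 2) (hZ : DifferentiableOn ℂ Z {s : ℂ | 1 / 2 < s.re}) {ω : ℂ}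
    (hω : 1 / 2 < ω.re) (hω1 : ω ≠ 1) {n : WithTop ℕ∞} : ContDiffAt ℂ n (kOmega R S δ M Z ω) ω := by
  classical
  -- an open neighbourhood of `ω` free of the other singularities
  set V : Set ℂ := {s : ℂ | 1 / 2 < s.re} ∩ {s | s ≠ 1} ∩ ⋂ ω' ∈ (S.toFinset.filter fun ω' ↦ ω' ≠ ω), {s | s ≠ ω'}
    with hV
  have hVo : IsOpen V :=
    ((isOpen_lt continuous_const Complex.continuous_re).inter isOpen_ne).inter (isOpen_biInter_finset fun _ _ ↦ isOpen_ne)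
  have hωV : ω ∈ V := by
    refine ⟨⟨hω, hω1⟩, ?_⟩
    simp only [mem_iInter, mem_setOf_eq]
    intro ω' hω' h
    rw [Finset.mem_filter] at hω'
    exact hω'.2 h.symm
  have hd : DifferentiableOn ℂ (kOmega R S δ M Z ω) V := by
    intro z hz
    have hz1 : (1 : ℝ) / 2 < z.re := hz.1.1
    have hzS : ∀ ω' ∈ S, ω' ≠ ω → z ≠ ω' := by
      intro ω' hω' hne
      have := hz.2
      simp only [mem_iInter, mem_setOf_eq] at this
      exact this ω' (Finset.mem_filter.2 ⟨Multiset.mem_toFinset.2 hω', hne⟩)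
    exact (differentiableAt_kOmega hδ2 hz1 hz.1.2 hzS
      (hZ.differentiableAt ((isOpen_lt continuous_const Complex.continuous_re).mem_nhds hz1))).differentiableWithinAt
  exact (hd.analyticAt (hVo.mem_nhds hωV)).contDiffAt

/-- **The explicit form of the residue function**: `Rfun ω y = y^{1+ω} Σ_{i<m} β_{ω,i} (log y)^i` (`y > 0`,
`m = count ω 𝒮 ≥ 1`), by the Leibniz rule. [cite: BrouckeDebruyneRevesz2023, proof of Theorem 3.2] -/
theorem Rfun_eq (hδ2 : δ < 1 / 2) (hZ : DifferentiableOn ℂ Z {s : ℂ | 1 / 2 < s.re}) {ω : ℂ} (hω : 1 / 2 < ω.re)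
    (hω1 : ω ≠ 1) (hm : 1 ≤ S.count ω) {y : ℝ} (hy : 0 < y) :
    Rfun R S δ M Z ω y =
      (y : ℂ) ^ (1 + ω) * ∑ i ∈ Finset.range (S.count ω), betaC R S δ M Z ω i * (Real.log y : ℂ) ^ i := by
  set n : ℕ := S.count ω - 1 with hn
  have hk : ContDiffAt ℂ n (kOmega R S δ M Z ω) ω := contDiffAt_kOmega hδ2 hZ hω hω1
  have hf : ContDiffAt ℂ n (fun s : ℂ ↦ (y : ℂ) ^ (1 + s)) ω := (contDiff_cpow_one_add hy).contDiffAt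
  have hL := iteratedDeriv_mul hf hk
  rw [Rfun, ← hn]
  rw [show (fun s ↦ (y : ℂ) ^ (1 + s) * kOmega R S δ M Z ω s) = (fun s : ℂ ↦ (y : ℂ) ^ (1 + s)) * kOmega R S δ M Z ω
    from rfl, hL]
  simp only [iteratedDeriv_cpow_one_add hy]
  -- compare the two finite sums
  have hrange : S.count ω = n + 1 := by omega
  rw [hrange, Finset.sum_div, Finset.mul_sum]
  refine Finset.sum_congr rfl fun i hi ↦ ?_
  simp only [betaC, hrange, Nat.add_sub_cancel]
  ring

/-! ### The derivative of `y^θ Σ c_j (log y)^j` -/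

/-- `d/dy (y:ℂ)^θ = θ (y:ℂ)^{θ−1}` for real `y > 0`. [folklore] -/
theorem hasDerivAt_ofReal_cpow {y : ℝ} (hy : 0 < y) (θ : ℂ) :
    HasDerivAt (fun u : ℝ ↦ (u : ℂ) ^ θ) (θ * (y : ℂ) ^ (θ - 1)) y := by
  have hy0 : (y : ℂ) ≠ 0 := ofReal_ne_zero.2 hy.ne'
  -- `u^θ = exp(θ log u)` near `y`
  have heq : (fun u : ℝ ↦ (u : ℂ) ^ θ) =ᶠ[𝓝 y] fun u ↦ Complex.exp (θ * (Real.log u : ℂ)) := by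
    filter_upwards [lt_mem_nhds hy] with u hu
    rw [Complex.cpow_def_of_ne_zero (ofReal_ne_zero.2 hu.ne'), ← Complex.ofReal_log hu.le, mul_comm]
  have hlog : HasDerivAt (fun u : ℝ ↦ (Real.log u : ℂ)) ((y⁻¹ : ℝ) : ℂ) y :=
    (Real.hasDerivAt_log hy.ne').ofReal_comp
  have h := ((hlog.const_mul θ).cexp)
  refine (h.congr_of_eventuallyEq heq).congr_deriv ?_
  rw [Complex.cpow_sub _ _ hy0, Complex.cpow_one, Complex.cpow_def_of_ne_zero hy0, ← Complex.ofReal_log hy.le,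
    mul_comm ((Real.log y : ℝ) : ℂ) θ]
  push_cast
  ring

/-- `d/dy (log y : ℂ)^j = j (log y)^{j−1}/y` for `y > 0` (`j ≥ 1`; for `j = 0` the derivative is `0`). [folklore] -/
theorem hasDerivAt_ofReal_log_pow {y : ℝ} (hy : 0 < y) (j : ℕ) :
    HasDerivAt (fun u : ℝ ↦ (Real.log u : ℂ) ^ j) ((j : ℂ) * (Real.log y : ℂ) ^ (j - 1) * ((y⁻¹ : ℝ) : ℂ)) y := by
  have hlog : HasDerivAt (fun u : ℝ ↦ (Real.log u : ℂ)) ((y⁻¹ : ℝ) : ℂ) y :=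
    (Real.hasDerivAt_log hy.ne').ofReal_comp
  exact hlog.pow j

/-- **`d/dy [y^θ Σ_{j<m} c_j (log y)^j] = y^{θ−1} Σ_{j<m} (θ c_j + (j+1) c_{j+1}) (log y)^j`** for `y > 0`
(with `c_m` read as it stands: the term `j = m−1` of the second part carries `m c_m (log y)^{m−1}`, which is the
`j = m − 1` summand; so the identity holds when `c_m = 0`, the case of interest, and we state it with that
hypothesis). [cite: BrouckeDebruyneRevesz2023, proof of Theorem 3.2 (Lemma 3.3 step, "x^ω Σ b̃_{ω,i}(log x)^i")] -/
theorem hasDerivAt_cpow_mul_logPoly {y : ℝ} (hy : 0 < y) (θ : ℂ) (c : ℕ → ℂ) (m : ℕ) (hcm : c m = 0) :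
    HasDerivAt (fun u : ℝ ↦ (u : ℂ) ^ θ * ∑ j ∈ Finset.range m, c j * (Real.log u : ℂ) ^ j)
      ((y : ℂ) ^ (θ - 1) * ∑ j ∈ Finset.range m, (θ * c j + (j + 1) * c (j + 1)) * (Real.log y : ℂ) ^ j) y := by
  have hy0 : (y : ℂ) ≠ 0 := ofReal_ne_zero.2 hy.ne'
  have h1 := hasDerivAt_ofReal_cpow hy θ
  have h2 : HasDerivAt (fun u : ℝ ↦ ∑ j ∈ Finset.range m, c j * (Real.log u : ℂ) ^ j)
      (∑ j ∈ Finset.range m, c j * ((j : ℂ) * (Real.log y : ℂ) ^ (j - 1) * ((y⁻¹ : ℝ) : ℂ))) y := by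
    exact HasDerivAt.fun_sum (u := Finset.range m) (A := fun j (u : ℝ) ↦ c j * (Real.log u : ℂ) ^ j)
      (A' := fun j ↦ c j * ((j : ℂ) * (Real.log y : ℂ) ^ (j - 1) * ((y⁻¹ : ℝ) : ℂ))) (x := y)
      fun j _ ↦ (hasDerivAt_ofReal_log_pow hy j).const_mul (c j)
  have h := h1.mul h2
  refine h.congr_deriv ?_
  -- algebra: `θ y^{θ−1} P + y^θ P' = y^{θ−1} Σ (θ c_j + (j+1) c_{j+1}) ℓ^j`
  set ℓ : ℂ := (Real.log y : ℂ) with hℓ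
  have hyθ : (y : ℂ) ^ θ = (y : ℂ) ^ (θ - 1) * y := by
    rw [Complex.cpow_sub _ _ hy0, Complex.cpow_one, div_mul_cancel₀ _ hy0]
  rw [hyθ]
  have hinv : ((y⁻¹ : ℝ) : ℂ) = (y : ℂ)⁻¹ := by push_cast; rfl
  simp only [hinv]
  -- second sum: shift the index
  have hshift : ∑ j ∈ Finset.range m, c j * ((j : ℂ) * ℓ ^ (j - 1) * (y : ℂ)⁻¹) =
      (y : ℂ)⁻¹ * ∑ j ∈ Finset.range m, ((j + 1 : ℂ) * c (j + 1)) * ℓ ^ j := by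
    rw [Finset.mul_sum]
    rcases Nat.eq_zero_or_pos m with hm | hm
    · subst hm; simp
    obtain ⟨k, rfl⟩ : ∃ k, m = k + 1 := ⟨m - 1, by omega⟩
    rw [Finset.sum_range_succ' (fun j ↦ c j * ((j : ℂ) * ℓ ^ (j - 1) * (y : ℂ)⁻¹)), Finset.sum_range_succ]
    simp only [Nat.cast_zero, zero_mul, mul_zero, add_zero, Nat.add_sub_cancel, hcm, mul_zero, zero_mul, add_zero,
      Nat.cast_add, Nat.cast_one]
    refine Finset.sum_congr rfl fun j _ ↦ ?_
    ring
  rw [hshift]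
  rw [Finset.mul_sum, Finset.mul_sum, Finset.mul_sum, ← Finset.sum_add_distrib, Finset.mul_sum]
  refine Finset.sum_congr rfl fun j _ ↦ ?_
  field_simp

/-! ### The top coefficient and the symmetry -/

/-- `β_{ω,m−1} = kOmega(ω)(ω)/(m−1)!` and `b_{ω,m−1} = (1+ω) kOmega(ω)(ω)/(m−1)!` (`m = count ω 𝒮 ≥ 1`).
[cite: BrouckeDebruyneRevesz2023, proof of Theorem 3.2 ("β̃_{ω,m−1} ≠ 0")] -/
theorem bCoef_top_eq (ω : ℂ) :
    bCoef R S δ M Z ω (S.count ω - 1) = (1 + ω) * (kOmega R S δ M Z ω ω / ((S.count ω - 1)! : ℂ)) := by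
  unfold bCoef betaC
  have h1 : (S.count ω - 1).choose (S.count ω - 1 + 1) = 0 := Nat.choose_succ_self _
  rw [h1, Nat.choose_self, Nat.sub_self, iteratedDeriv_zero]
  simp

/-- `kOmega(ω)(ω) ≠ 0` for `ω ∈ 𝒮` with `Re ω > 1/2` when `ℛ ∩ 𝒮 = ∅`, `δ < 1/2`, `Re ω < 1` (`Re ω > 0`).
[cite: BrouckeDebruyneRevesz2023, proof of Theorem 3.2] -/
theorem kOmega_self_ne_zero (hRS : Disjoint R S) (hδ2 : δ < 1 / 2) {ω : ℂ} (hωS : ω ∈ S) (hω : 1 / 2 < ω.re)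
    (hω1 : ω.re < 1) : kOmega R S δ M Z ω ω ≠ 0 := by
  have hω0 : ω ≠ 0 := fun h ↦ by rw [h] at hω; simp at hω; linarith
  have hω1' : ω - 1 ≠ 0 := fun h ↦ by
    have := congrArg Complex.re h; simp at this; linarith
  have hωp1 : ω + 1 ≠ 0 := fun h ↦ by
    have := congrArg Complex.re h; simp at this; linarith
  have hωδ : ω - δ ≠ 0 := fun h ↦ by
    have := congrArg Complex.re h; simp at this; linarith
  unfold kOmega hOmega tailF
  refine div_ne_zero ?_ (mul_ne_zero hω0 hωp1)
  refine mul_ne_zero (mul_ne_zero (mul_ne_zero (pow_ne_zero _ hω0) (div_ne_zero hω0 hω1')) ?_)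
    (mul_ne_zero (mul_ne_zero ?_ (pow_ne_zero _ (div_ne_zero hω0 hωδ))) (Complex.exp_ne_zero _))
  · refine Multiset.prod_ne_zero fun h ↦ ?_
    obtain ⟨ω', hω', h0⟩ := Multiset.mem_map.1 h
    rw [Multiset.mem_filter] at hω'
    exact div_ne_zero hω0 (sub_ne_zero.2 hω'.2.symm) h0
  · refine Multiset.prod_ne_zero fun h ↦ ?_
    obtain ⟨ρ, hρ, h0⟩ := Multiset.mem_map.1 h
    have hne : ρ ≠ ω := fun e ↦ Multiset.disjoint_left.1 hRS hρ (e ▸ hωS)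
    exact div_ne_zero (sub_ne_zero.2 hne.symm) hω0 h0

/-- **`b_{ω,m−1} ≠ 0`** for `ω ∈ 𝒮` with `1/2 < Re ω < 1` (`ℛ ∩ 𝒮 = ∅`, `δ < 1/2`).
[cite: BrouckeDebruyneRevesz2023, Theorem 3.2 ("b_{ω,m_𝒮(ω)−1} ≠ 0")] -/
theorem bCoef_top_ne_zero (hRS : Disjoint R S) (hδ2 : δ < 1 / 2) {ω : ℂ} (hωS : ω ∈ S) (hω : 1 / 2 < ω.re)
    (hω1 : ω.re < 1) : bCoef R S δ M Z ω (S.count ω - 1) ≠ 0 := by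
  have hωp1 : 1 + ω ≠ 0 := fun h ↦ by
    have := congrArg Complex.re h; simp at this; linarith
  rw [bCoef_top_eq]
  refine mul_ne_zero hωp1 (div_ne_zero (kOmega_self_ne_zero hRS hδ2 hωS hω hω1) ?_)
  exact_mod_cast (Nat.factorial_pos _).ne'

/-- Multiset products are compatible with conjugation: `∏_X φ(conj a) = conj ∏_X ψ(a)` when
`f₁ (conj a) = conj (f₂ a)`. [folklore] -/
theorem prod_map_conj {X : Multiset ℂ} {f₁ f₂ : ℂ → ℂ} (h : ∀ a ∈ X, f₁ (conj a) = conj (f₂ a)) :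
    ((X.map conj).map f₁).prod = conj ((X.map f₂).prod) := by
  rw [Multiset.map_map, map_multiset_prod, Multiset.map_map]
  congr 1
  exact Multiset.map_congr rfl fun a ha ↦ h a ha

/-- For symmetric `𝒮, ℛ` and `Z(s̄) = \overline{Z(s)}`: `kOmega ω̄ s̄ = \overline{kOmega ω s}`.
[cite: BrouckeDebruyneRevesz2023, §3 (symmetric multisets)] -/
theorem kOmega_conj (hSsymm : S.map conj = S) (hRsymm : R.map conj = R) (hZ : ∀ s, Z (conj s) = conj (Z s))
    (ω s : ℂ) : kOmega R S δ M Z (conj ω) (conj s) = conj (kOmega R S δ M Z ω s) := by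
  classical
  have hcount : S.count (conj ω) = S.count ω := by
    conv_lhs => rw [← hSsymm]
    exact Multiset.count_map_eq_count' _ _ (RingHom.injective _) _
  -- the filtered product
  have hfilt : (S.filter fun ω' ↦ ω' ≠ conj ω) = (S.filter fun ω' ↦ ω' ≠ ω).map conj := by
    conv_lhs => rw [← hSsymm]
    rw [Multiset.filter_map]
    congr 1
    exact Multiset.filter_congr fun a _ ↦ by
      simp only [Function.comp, ne_eq]
      exact (RingHom.injective (starRingEnd ℂ)).ne_iff
  unfold kOmega hOmega tailF
  rw [hcount, hfilt]
  rw [prod_map_conj (f₂ := fun ω' ↦ s / (s - ω')) (fun a _ ↦ by simp [map_div₀, map_sub])]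
  have hR : (R.map fun ρ ↦ (conj s - ρ) / conj s).prod = conj ((R.map fun ρ ↦ (s - ρ) / s).prod) := by
    conv_lhs => rw [← hRsymm]
    exact prod_map_conj (X := R) (f₁ := fun ρ ↦ (conj s - ρ) / conj s) (f₂ := fun ρ ↦ (s - ρ) / s)
      (fun a _ ↦ by simp [map_div₀, map_sub])
  rw [hR, hZ s]
  simp only [map_div₀, map_mul, map_sub, map_add, map_pow, map_one, Complex.conj_ofReal, ← Complex.exp_conj,
    map_multiset_prod, Multiset.map_map]

/-- **`b_{ω̄,j} = \overline{b_{ω,j}}`** for symmetric data. [cite: BrouckeDebruyneRevesz2023, Theorem 3.2 (symmetric 𝒮)] -/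
theorem bCoef_conj (hSsymm : S.map conj = S) (hRsymm : R.map conj = R) (hZ : ∀ s, Z (conj s) = conj (Z s))
    (ω : ℂ) (j : ℕ) : bCoef R S δ M Z (conj ω) j = conj (bCoef R S δ M Z ω j) := by
  have hcount : S.count (conj ω) = S.count ω := by
    conv_lhs => rw [← hSsymm]
    exact Multiset.count_map_eq_count' _ _ (RingHom.injective _) _
  have hk : kOmega R S δ M Z (conj ω) = fun s ↦ conj (kOmega R S δ M Z ω (conj s)) := by
    funext s
    have := kOmega_conj (δ := δ) (M := M) hSsymm hRsymm hZ ω (conj s)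
    rwa [Complex.conj_conj] at this
  have hiter : ∀ n, iteratedDeriv n (kOmega R S δ M Z (conj ω)) (conj ω) = conj (iteratedDeriv n (kOmega R S δ M Z ω) ω) := by
    intro n
    rw [hk, iteratedDeriv_conj_comp_conj]
    beta_reduce
    rw [Complex.conj_conj]
  have hβ : ∀ i, betaC R S δ M Z (conj ω) i = conj (betaC R S δ M Z ω i) := by
    intro i
    unfold betaC
    rw [hcount, hiter]
    simp [map_div₀]
  unfold bCoef
  rw [hβ, hβ]
  simp [map_add, map_mul]

end BDRMultiset

end Literature.NumberTheory.BeurlingPrimes
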